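import Mathlib.NumberTheory.Padics.PadicNumbers
import Literature.AnabelianGeometry.SemiGraphs.TemperedCurves
import Literature.AnabelianGeometry.SemiGraphs.TemperedVerticial
import HarnessLib

/-!
# Example 3.10 (special fibre), Remark 3.10.1 and Corollary 3.11: reconstruction of the
# semi-graph of anabelioids of a pointed stable curve from its tempered fundamental group

Mochizuki, *Semi-graphs of anabelioids*, Publ. RIMS **42** (2006), §3, manuscript pp. 43–49
[cite: MochizukiSemiAnbd2006, §3 pp.43-49], typed over the INTERFACE `TemperedArithmeticGroup K`
(`TemperedCurves.lean`) and the local presentation `ProfiniteSemiGraph` / `TemperedPiChart`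
(`TemperedCoverings.lean`, `TemperedVerticial.lean`).

* `SpecialFibreData D` — the second half of Example 3.10 (p. 44): "`G` (respectively, `G^c`) the
  graph of anabelioids (respectively, semi-graph of anabelioids) determined by the semi-graph of
  profinite groups [without compact structure!] (respectively, with compact structure) associated
  to the geometric special fiber of the stable model of `X^log_K`", with "a natural equivalence
  `B^temp(G) ⥲ B^temp(G^c)` and a natural full embedding `B^temp(G) ↪ B^temp(Δ)`", the latter
  recorded (p. 45, p. 48 "the natural quotient `Δ ↠ π₁^temp(G) ≅ π₁^temp(G^c)`") as a continuous
  surjection `Δ ↠ π₁^temp(G^c)` onto a tempered fundamental group chart of `G^c`; its origin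
  predicate `SpecialFibreOrigin` (hypothesis structure, as in `TemperedCurves.lean`);
* Remark 3.10.1 (p. 45): the pro-`Σ` tempered fundamental group, as the data of a quotient of
  `Π` (`ProSigmaQuotient`), with its printed characterisation recorded in the docstring;
* Corollary 3.11 (pp. 45–46) as the predicate `Cor311` on origin hypotheses: an isomorphism of
  topological groups `γ : Δ[α] ⥲ Δ[β]` "determines a compatible isomorphism of semi-graphs of
  anabelioids `G^c[α] ⥲ G^c[β]` … Moreover, if such a `γ` exists, then `p_α = p_β`";
  Remark 3.11.1 (pro-`Σ` version, `Rmk3111` over `ProSigmaOrigin`; conclusion deliberately weaker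
  than print — see its docstring); Remark 3.11.2 (expository pointer to [Tama1]: "one
  may apply the results of [Tama1] to the various verticial subgroups … to recover, in certain
  cases, the isomorphism class of the curve …" — not typed).

Typing discipline (cell abc-iut): statements about THE tempered fundamental group / special fibre
of a curve are predicates on the hypothesis structures `TemperedPiOrigin`, `SpecialFibreOrigin`,
assumed by consumers and asserted for no instance. No statement of the paper is strengthened;
"functorial in `γ`" of Cor. 3.11 is typed as uniqueness of the underlying isomorphism of
semi-graphs among the compatible ones (which yields functoriality); the anabelioid-level
isomorphism is unique only up to the conjugation indeterminacy of the presentation (Rmk. 2.4.2)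
and that finer uniqueness is recorded here, not typed.
-/

open CategoryTheory Topology

noncomputable section

namespace Literature.AnabelianGeometry.SemiGraphs

universe u

namespace ProfiniteSemiGraph

variable {𝒢 ℋ : ProfiniteSemiGraph.{u}}

/-- An *isomorphism* of semi-graphs of anabelioids in the local presentation: a morphism that is
an isomorphism of underlying semi-graphs (bijective on vertices and on edges — hence on branches —
and respecting "abuts to no vertex") and locally trivial (all vertex/edge homomorphisms bijective)
(Def. 2.1 p. 22, Def. 2.2 (ii) p. 24). [cite: MochizukiSemiAnbd2006, Def 2.2(ii) p.24] -/
@[mk_iff] structure Hom.IsIso (F : Hom 𝒢 ℋ) : Prop where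
  /-- bijective on vertices -/
  bijective_vertexMap : Function.Bijective F.base.vertexMap
  /-- bijective on edges -/
  bijective_edgeMap : Function.Bijective F.base.edgeMap
  /-- branches abutting to no vertex go to branches abutting to no vertex -/
  abuts_none : ∀ b : 𝒢.graph.Branch, 𝒢.graph.abuts b = none → ℋ.graph.abuts (F.base.branchMap b) = none
  /-- an isomorphism on every constituent anabelioid -/
  isLocallyTrivial : F.IsLocallyTrivial

end ProfiniteSemiGraph

open ProfiniteSemiGraph

/-! ### Example 3.10, second half: the semi-graph of anabelioids of the special fibre -/

variable {K : Type u} [Field K]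

/-- **Example 3.10**, second half ([SemiAnbd] pp. 44–45), as INTERFACE data attached to
`D : TemperedArithmeticGroup K` (`Δ = D.delta`): the semi-graph of anabelioids `G^c` "determined by
the semi-graph of profinite groups … with compact structure associated to the geometric special
fiber of the stable model of `X^log_K`" (vertices = irreducible components, closed edges = nodes,
open edges = cusps), a tempered fundamental group chart of `G^c` (it "satisfies the hypotheses of
Theorem 3.7, Corollary 3.9", p. 44, via Example 2.10), and the "natural full embedding
`B^temp(G) ↪ B^temp(Δ)`" (p. 44), i.e. (pp. 45, 48) "the natural quotient
`Δ ↠ π₁^temp(G) ≅ π₁^temp(G^c)`", recorded as a continuous surjection. The graph of anabelioids `G`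
"[without compact structure!]" is `G^c` with its open edges removed; "`B^temp(G) ⥲ B^temp(G^c)`"
(p. 44). Nothing asserts such data exists for a given `D`. [cite: MochizukiSemiAnbd2006, Ex 3.10 p.44] -/
structure SpecialFibreData (D : TemperedArithmeticGroup K) : Type (u + 1) where
  /-- `G^c`, the semi-graph of anabelioids with compact structure of the geometric special fibre -/
  Gc : ProfiniteSemiGraph.{u}
  /-- `G^c` satisfies the hypotheses of Theorem 3.7 (p. 44, from Example 2.10) -/
  hyp : Gc.Thm37Hypotheses
  /-- a tempered fundamental group `π₁^temp(G^c)` with `B^temp(G^c) ≌ B^temp(π₁^temp(G^c))` -/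
  chart : TemperedPiChart Gc
  /-- "the natural quotient `Δ ↠ π₁^temp(G) ≅ π₁^temp(G^c)`" (pp. 45, 48) -/
  admissible : D.delta →ₜ* chart.G
  /-- it is surjective -/
  admissible_surjective : Function.Surjective admissible

/-- ORIGIN PREDICATE for special-fibre data, as a hypothesis structure (see `TemperedPiOrigin`):
"`S` IS the special-fibre semi-graph of anabelioids with compact structure of the stable model of
the curve of which `D` is the tempered fundamental group, with its admissible quotient"
([SemiAnbd] Ex. 3.10 p. 44). Threaded by consumers as a parameter; asserted for no instance.
[cite: MochizukiSemiAnbd2006, Ex 3.10 p.44] -/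
structure SpecialFibreOrigin (K : Type u) [Field K] : Type (u + 1) extends TemperedPiOrigin K where
  /-- "`S` is the special-fibre data of the curve underlying `D`" -/
  IsSpecialFibreOf : (D : TemperedArithmeticGroup K) → SpecialFibreData D → Prop
  /-- special-fibre data is only certified for tempered groups of geometric origin -/
  isOfGeometricOrigin_of_isSpecialFibreOf : ∀ (D : TemperedArithmeticGroup K)
    (S : SpecialFibreData D), IsSpecialFibreOf D S → IsOfGeometricOrigin D

/-! ### Remark 3.10.1: the pro-`Σ` tempered fundamental group -/

/-- **Remark 3.10.1** ([SemiAnbd] p. 45), as INTERFACE data: for a set of primes `Σ`, the *pro-`Σ`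
tempered fundamental group* of `X^log_K` — "the tempered fundamental group of [the] temperoid
`B^temp(X^log_K)^Σ ⊆ B^temp(X^log_K)`, the full subcategory determined by the tempered coverings
dominated by coverings which arise as a combinatorial covering [i.e., a covering arising from a
graph-covering of the dual graph of the geometric special fiber] of a finite étale Galois covering
of `X^log_K` whose degree is a `Σ`-integer" — recorded as a quotient of `Π` by a closed normal
subgroup. "As long as `Σ` contains at least one prime `≠ p`, the entire discussion of Example 3.10
may be carried out for the pro-`Σ` tempered fundamental group", and the analogue of `G`, `G^c` "is
precisely the pro-`Σ` completion … of `G` (respectively, `G^c`)". Nothing asserts such data exists.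
SCHEMA-CLASS BINDER (audit L1-t10 F3, recorded): the parameter `Sigma` is NOT constrained by any
field of this structure (the fields only record a closed normal subgroup of `Π` and one of `Δ`); the
`Σ`-content — that these ARE the kernels of the pro-`Σ` quotients — is carried solely by the
certification predicate `ProSigmaOrigin.IsProSigmaOf D Σ Q`, which every consumer must thread.
[cite: MochizukiSemiAnbd2006, Rmk 3.10.1 p.45] -/
structure ProSigmaQuotient (D : TemperedArithmeticGroup K) (Sigma : Set ℕ) : Type u where
  /-- the kernel of `Π ↠ Π^Σ`, the pro-`Σ` tempered fundamental group of `X^log_K` being `Π/ker`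
  (Rmk. 3.10.1, arithmetic) -/
  ker : Subgroup D.Pi
  /-- it is normal -/
  [normal : ker.Normal]
  /-- it is closed -/
  isClosed : IsClosed (ker : Set D.Pi)
  /-- `I_Σ := Ker(Δ ↠ Δ^Σ)`, the kernel of the pro-`Σ` tempered fundamental group of the GEOMETRIC
  curve `(X^log)_{K̄}` (Cor. 3.11, proof, p. 46; Rmk. 3.11.1 p. 49 "the respective pro-`Σ` tempered
  fundamental groups") — a separate datum: print does not identify it with `Ker(Π ↠ Π^Σ) ∩ Δ` -/
  kerDelta : Subgroup D.delta
  /-- it is normal -/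
  [normalDelta : kerDelta.Normal]
  /-- it is closed -/
  isClosed_kerDelta : IsClosed (kerDelta : Set D.delta)
  /-- the formal inclusion `I_Σ ⊆ Ker(Π ↠ Π^Σ) ∩ Δ` (a `Σ`-covering of `X_K` of degree a
  `Σ`-integer restricts to one of `X_{K̄}`) -/
  kerDelta_le : kerDelta ≤ ker.subgroupOf D.delta

attribute [instance] ProSigmaQuotient.normal ProSigmaQuotient.normalDelta

/-- ORIGIN PREDICATE for pro-`Σ` quotient data, as a hypothesis structure extending
`SpecialFibreOrigin`: "`Q` IS the kernel of `Π ↠ Π^Σ`, the pro-`Σ` tempered fundamental group of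
Remark 3.10.1 of the curve underlying `D`" (p. 45). Threaded by consumers; asserted for no instance.
[cite: MochizukiSemiAnbd2006, Rmk 3.10.1 p.45] -/
structure ProSigmaOrigin (K : Type u) [Field K] : Type (u + 1) extends SpecialFibreOrigin K where
  /-- "`Q` is the pro-`Σ` quotient datum of the curve underlying `D`": `Q.ker = Ker(Π ↠ Π^Σ)`
  (Rmk. 3.10.1) AND `Q.kerDelta = Ker(Δ ↠ Δ^Σ)` (the geometric pro-`Σ` tempered group, p. 46) -/
  IsProSigmaOf : (D : TemperedArithmeticGroup K) → (Sig : Set ℕ) → ProSigmaQuotient D Sig → Prop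
  /-- pro-`Σ` data are only certified for tempered groups of geometric origin -/
  isOfGeometricOrigin_of_isProSigmaOf : ∀ (D : TemperedArithmeticGroup K) (Sig : Set ℕ)
    (Q : ProSigmaQuotient D Sig), IsProSigmaOf D Sig Q → IsOfGeometricOrigin D

/-! ### Corollary 3.11 -/

section Cor311

variable {Kα : Type u} [Field Kα] {Kβ : Type u} [Field Kβ]

/-- Compatibility of an isomorphism of semi-graphs of anabelioids `F : G^c[α] ⥲ G^c[β]` with an
isomorphism `γ : Δ[α] ⥲ Δ[β]` through the admissible quotients (Cor. 3.11 p. 46 "compatible";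
proof p. 49: `γ` "induces an isomorphism `π₁^temp(G[α]) ≅ π₁^temp(G[β])`" which by Cor. 3.9 comes from
`F`): there is an isomorphism `φ` of the tempered fundamental groups of the special fibres with
`φ ∘ q_α = q_β ∘ γ`, compatible, up to conjugation, with the verticial HOMOMORPHISMS at `v` and
`F(v)` (`IsVerticialHom`, pinned up to conjugation; audit A-L3t2-F3, ruling κ) and the vertex
isomorphisms of `F`. [cite: MochizukiSemiAnbd2006, Cor 3.11 p.46] -/
def Cor311Compatible {Dα : TemperedArithmeticGroup Kα} {Dβ : TemperedArithmeticGroup Kβ}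
    (Sα : SpecialFibreData Dα) (Sβ : SpecialFibreData Dβ) (γ : Dα.delta ≃ₜ* Dβ.delta)
    (F : Hom Sα.Gc Sβ.Gc) : Prop :=
  ∃ φ : Sα.chart.G ≃ₜ* Sβ.chart.G,
    (∀ x : Dα.delta, φ (Sα.admissible x) = Sβ.admissible (γ x)) ∧
    ∀ (v : Sα.Gc.graph.Vertex) (ψα : Sα.Gc.Gv v →ₜ* Sα.chart.G)
      (ψβ : Sβ.Gc.Gv (F.base.vertexMap v) →ₜ* Sβ.chart.G),
      IsVerticialHom Sα.chart v ψα → IsVerticialHom Sβ.chart (F.base.vertexMap v) ψβ →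
        ∃ g : Sβ.chart.G, ∀ x, φ (ψα x) = g * ψβ (F.hV v x) * g⁻¹

/-- **Corollary 3.11 (Reconstruction of Semi-graphs of Anabelioids Associated to Pointed Stable
Curves)** ([SemiAnbd] §3 pp. 45–46), as a predicate on the origin hypotheses (assumed by consumers,
asserted for no instance): "For `□ = α, β`, let `K_□` be a finite extension of `ℚ_{p_□}` … `(X^log_□)`
a smooth log curve over `K_□` … `Δ[□] := π₁^temp((X^log_□)_{K̄_□})`; `G[□]` (respectively, `G^c[□]`)
the graph of anabelioids (respectively, semi-graph of anabelioids) … associated to the geometric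
special fiber of the stable model … Then any isomorphism of topological groups `γ : Δ[α] ⥲ Δ[β]`
determines a compatible isomorphism of semi-graphs of anabelioids `G^c[α] ⥲ G^c[β]` in a fashion
that is functorial with respect to `γ`. Moreover, if such a `γ` exists, then `p_α = p_β`."
Functoriality is typed as uniqueness of the underlying isomorphism of semi-graphs among the
compatible ones. [cite: MochizukiSemiAnbd2006, Cor 3.11 pp.45-46] -/
def Cor311 (pα pβ : ℕ) [Fact pα.Prime] [Fact pβ.Prime] [Algebra ℚ_[pα] Kα]
    [FiniteDimensional ℚ_[pα] Kα] [Algebra ℚ_[pβ] Kβ] [FiniteDimensional ℚ_[pβ] Kβ]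
    (Ωα : SpecialFibreOrigin Kα) (Ωβ : SpecialFibreOrigin Kβ) : Prop :=
  ∀ (Dα : TemperedArithmeticGroup Kα) (Dβ : TemperedArithmeticGroup Kβ)
    (Sα : SpecialFibreData Dα) (Sβ : SpecialFibreData Dβ),
    Ωα.IsSpecialFibreOf Dα Sα → Ωβ.IsSpecialFibreOf Dβ Sβ →
    ∀ γ : Dα.delta ≃ₜ* Dβ.delta,
      (∃ F : Hom Sα.Gc Sβ.Gc, F.IsIso ∧ Cor311Compatible Sα Sβ γ F ∧
        ∀ F' : Hom Sα.Gc Sβ.Gc, F'.IsIso → Cor311Compatible Sα Sβ γ F' →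
          F'.base.vertexMap = F.base.vertexMap ∧ F'.base.edgeMap = F.base.edgeMap) ∧
      pα = pβ

/-- **Remark 3.11.1** ([SemiAnbd] p. 49), as a predicate on the origin hypotheses
`Ωα Ωβ : ProSigmaOrigin` (which certify the special-fibre AND the pro-`Σ` quotient data; assumed by
consumers, asserted for no instance): "for any set of primes `Σ` of cardinality `≥ 3` [i.e., so that
`Σ` contains at least one prime `≠ p_α, p_β`], the argument given above also yields a 'pro-`Σ`
version' of Corollary 3.11, i.e., where one replaces the isomorphism `γ : Δ[α] ⥲ Δ[β]` … by an
isomorphism `Δ[α]^Σ ⥲ Δ[β]^Σ` between the respective pro-`Σ` tempered fundamental groups" — the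
GEOMETRIC pro-`Σ` quotients `Δ/I_Σ` (`ProSigmaQuotient.kerDelta`, certified by `Ω`) — WITH the
author's added hypothesis (Comments on [SemiAnbd], May 2020, item (3.): "in the discussion of the
'pro-`Σ` version' of Corollary 3.11 in Remark 3.11.1, one should assume that `p_α, p_β ∈ Σ`. In
fact, this assumption is, in some sense, implicit in the phraseology … but it should have been
stated explicitly"): `p_α ∈ Σ` and `p_β ∈ Σ`. Typed conclusion: an isomorphism of the semi-graphs of
anabelioids of the special fibres exists and `p_α = p_β`. DELIBERATELY WEAKER THAN PRINT (recorded):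
the printed conclusion is the full analogue of Cor. 3.11 — a COMPATIBLE isomorphism, functorial in
the given one — whose compatibility clause refers to the pro-`Σ` tempered fundamental groups
`π₁^temp(G^c_Σ)` of the pro-`Σ` completions of the special fibres (Rmk. 3.10.1), data not carried by
`SpecialFibreData`; it is to be added with that data.
[cite: MochizukiSemiAnbd2006, Rmk 3.11.1 p.49 and Comments (May 2020) item 3] -/
def Rmk3111 (pα pβ : ℕ) [Fact pα.Prime] [Fact pβ.Prime] [Algebra ℚ_[pα] Kα]
    [FiniteDimensional ℚ_[pα] Kα] [Algebra ℚ_[pβ] Kβ] [FiniteDimensional ℚ_[pβ] Kβ]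
    (Ωα : ProSigmaOrigin Kα) (Ωβ : ProSigmaOrigin Kβ) : Prop :=
  ∀ (Sig : Set ℕ), (∀ q ∈ Sig, q.Prime) → 3 ≤ Sig.encard → pα ∈ Sig → pβ ∈ Sig →
  ∀ (Dα : TemperedArithmeticGroup Kα) (Dβ : TemperedArithmeticGroup Kβ)
    (Sα : SpecialFibreData Dα) (Sβ : SpecialFibreData Dβ)
    (Qα : ProSigmaQuotient Dα Sig) (Qβ : ProSigmaQuotient Dβ Sig),
    Ωα.IsSpecialFibreOf Dα Sα → Ωβ.IsSpecialFibreOf Dβ Sβ →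
    Ωα.IsProSigmaOf Dα Sig Qα → Ωβ.IsProSigmaOf Dβ Sig Qβ →
    Nonempty ((Dα.delta ⧸ Qα.kerDelta) ≃ₜ* (Dβ.delta ⧸ Qβ.kerDelta)) →
      (∃ F : Hom Sα.Gc Sβ.Gc, F.IsIso) ∧ pα = pβ

end Cor311

end Literature.AnabelianGeometry.SemiGraphs

end
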